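import Summits.QuantumFields.BalabanUV.Beta.GAN24.ThirdJetKernel
import Literature.MathematicalPhysics.QuantumFieldTheory.Balaban1983to89.Beta.DecLiftAdjoint
import Literature.MathematicalPhysics.QuantumFieldTheory.Balaban1983to89.Beta.BalabanStepW2

/-!
# `BalabanUV.Gaps.D1PinnedColourScaling` — cell pub-balaban-gaps, row (D1), seat g1-p1: THE FIRST-ORDER TABLES OF THE PINNED FAMILY UNDER COLOUR SCALING
# `c⃗ ↦ t·c⃗` — an2's composite stencil `Sc` and value-function third jet `e3Of` are HOMOGENEOUS OF DEGREE 1 in `(cE, cVH, cΛ)`, hence the step stencil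
# `Sstep` is a QUADRATIC part `t²·(cE·wE)•e3Of c⃗` plus a LINEAR part `t·Sstep 0 cVH cΛ`: the first brick of the degree count «`φ` is a quartic» (census row 71 (d))

HONEST FRAMING (cell rule, page 1 of everything): [folklore] unfolding of an2's DEFINITIONS (`BalabanCompositeJets.Sc ∕ pushSum`, `BalabanStepJets.S0`, `BalabanStepJetsSucc.e3Of ∕
Sstep`, `BalabanStepW2.Spure ∕ M1`) and finite-sum ∕ superposition homogeneity BY NAME (`DecLiftAdjoint.vertexOf_smul`, `KernelReflection.comp_smul_left ∕ comp_smul_right`,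
`ThirdJetKernel.mmRead_smul`); NOTHING of Bałaban's asserted; no value computed; (P6) untouched; (D1) NOT discharged; 0∕4 row-D1 binders; NOT `BetaPertH`, NOT continuum,
NOT Clay.  HONEST DEPENDENCY (b2b cell, verbatim): «continuum YM on T⁴ ⇐ BetaPertH ∧ nine spine estimates (0/9 proved); BetaPertH ⇐ (D1) ∧ (D4) ∧ CAP+tail; G-an2-4 gates
asym, D1 and NE2/3/4.»

WHY (row (D1); census row 71 (d) of `HOME/g1/RESIDUE.md`).  By this seat's GEN 10 structure theorem the pinned family's limit coefficient is `γ(r) + φ(c⃗) + cB·σ(r) + λ(Tc)`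
with `φ` the only piece seeing the first-order colour triple `c⃗ = (cE,cVH,cΛ)`.  The degree count «`φ` is a polynomial of degree ≤ 4» starts from the fact typed HERE: an2's
first-order tables are NOT linear in `c⃗` — the composite stencil `Sc c⃗ n` and the third jet `e3Of c⃗ j = −mmRead (K ∘ vertexOf (Sc c⃗ (j−1)) ∘ K)` ARE homogeneous of degree 1
(§1–§2), but the step stencil `Sstep c⃗ j = (cE·wE j)•e3Of c⃗ j + (cVH·wVH j)•mfNeg ∘ vhS + (cΛ·wΛ j)•SLam …` multiplies `e3Of c⃗` by `cE` once more, so under `c⃗ ↦ t·c⃗` it splits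
as `t²·(quadratic part) + t·(linear part)` (§3), and so does an2's unfolded stencil `Spure` (§3); `S₀` and the multiplier table `M1` are homogeneous of degree 1.  (The
remaining steps of the count — the carrier's first-order part and `K3OfK`'s `W`-free part are quadratic in the first-order tables, the bubble quadratic, the `T₂`-tower linear —
are NOT typed here; census row 71 (d).)
CONTENT (all [folklore]; no `def`, no `def … : Prop`, nothing cited as a hypothesis, 0 sorry): §1 `pushSum_smul`, **`Sc_colourScale`** (`Sc (t·cE) (t·cVH) (t·cΛ) n = t • Sc cE cVH cΛ n`);
§2 **`e3Of_colourScale`**; §3 `S0_colourScale`, `M1_colourScale`, **`Sstep_colourScale`** (`Sstep (t·c⃗) j κ u = t²•((cE·wE j)•e3Of c⃗ j κ u) + t•Sstep 0 cVH cΛ j κ u`),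
**`Spure_colourScale_succ`** (the same split for an2's `Spure … (j+1)`), `Spure_colourScale_zero` (member `0` is homogeneous of degree 1).

Provenance: cell pub-balaban-gaps, seat g1-p1 GEN 10 (prover-pub-balaban-gaps-g1-p1-g10-0), 2026-08-23; imports gan24's `GAN24.ThirdJetKernel`, the Literature `Beta.DecLiftAdjoint`
and `Beta.BalabanStepW2` ONLY (built); no existing file touched.
-/

noncomputable section

open Finset
open scoped BigOperators
open Literature.MathematicalPhysics.QuantumFieldTheory Balaban1983to89 Balaban1983to89.Beta
open ExpKernelCalculus (MKer comp)
open OneStepResolventKernel (Fib KInv vertexOf)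
open BalabanCompositeJets (Sc Sc_zero Sc_succ pushSum)
open BalabanStepJets (S0)
open BalabanStepJetsSucc (mmRead e3Of Sstep)
open BalabanStepW2 (Spure M1)
open StepJetData (mfNeg)
open DecLiftAdjoint (vertexOf_smul)
open Summit.QuantumFields.BalabanUV.Beta.GAN24.ThirdJetKernel (mmRead_smul)

namespace Summit.QuantumFields.BalabanUV.Gaps.D1PinnedColourScaling

variable {d : ℕ} {Lc : ℕ} [NeZero Lc]

/-! ## §1 an2's composite stencil is homogeneous of degree 1 in the colour triple -/

omit [NeZero Lc] in
/-- [folklore] The one-step push of the multiplier legs is homogeneous (a finite sum). -/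
theorem pushSum_smul (M L : ℕ) (t : ℝ) (K : MKer (d + 1) (Fib d)) : pushSum M L (t • K) = t • pushSum M L K := by
  funext x w a b
  simp only [BalabanCompositeJets.pushSum, Pi.smul_apply, smul_eq_mul, Finset.mul_sum]
  refine Finset.sum_congr rfl fun i _ => Finset.sum_congr rfl fun i' _ => ?_
  ring

/-- [folklore] The first-step stencil `S₀` is homogeneous of degree 1 in `(cE, cVH, cΛ)`. -/
theorem S0_colourScale (t cE cVH cΛ : ℝ) : S0 d Lc (t * cE) (t * cVH) (t * cΛ) = t • S0 d Lc cE cVH cΛ := by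
  funext κ u x z a b
  simp only [BalabanStepJets.S0, Pi.add_apply, Pi.smul_apply, smul_eq_mul]
  ring

/-- [folklore] **an2's COMPOSITE STENCIL IS HOMOGENEOUS OF DEGREE 1 IN THE COLOUR TRIPLE**: `Sc (t·cE) (t·cVH) (t·cΛ) n = t • Sc cE cVH cΛ n` (induction on the level:
`Sc 0 = S₀`; the step is a push of the previous level plus two summands each carrying one colour constant). -/
theorem Sc_colourScale (t cE cVH cΛ : ℝ) : ∀ n : ℕ, Sc d Lc (t * cE) (t * cVH) (t * cΛ) n = t • Sc d Lc cE cVH cΛ n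
  | 0 => by rw [Sc_zero, Sc_zero, S0_colourScale]
  | n + 1 => by
    rw [Sc_succ, Sc_succ, Sc_colourScale t cE cVH cΛ n]
    funext κ u x z a b
    simp only [Pi.add_apply, Pi.smul_apply, smul_eq_mul, pushSum_smul]
    ring

/-! ## §2 The value-function third jet is homogeneous of degree 1 -/

/-- [folklore] **`e3Of` IS HOMOGENEOUS OF DEGREE 1 IN THE COLOUR TRIPLE**: `e3Of (t·cE) (t·cVH) (t·cΛ) j = t • e3Of cE cVH cΛ j` (§1 through BCJ's one-shot vertex —
`DecLiftAdjoint.vertexOf_smul` —, the two resolvent compositions and the coarse read-out). -/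
theorem e3Of_colourScale (t cE cVH cΛ : ℝ) (j : ℕ) : e3Of d Lc (t * cE) (t * cVH) (t * cΛ) j = t • e3Of d Lc cE cVH cΛ j := by
  funext κ' u' x' z' a b
  simp only [BalabanStepJetsSucc.e3Of, Pi.smul_apply, smul_eq_mul]
  rw [Sc_colourScale t cE cVH cΛ (j - 1)]
  have hv : vertexOf (N := Lc ^ j) (t • Sc d Lc cE cVH cΛ (j - 1)) κ' u' = t • vertexOf (N := Lc ^ j) (Sc d Lc cE cVH cΛ (j - 1)) κ' u' :=
    vertexOf_smul (N := Lc ^ j) t (Sc d Lc cE cVH cΛ (j - 1)) κ' u'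
  rw [hv, KernelReflection.comp_smul_right, KernelReflection.comp_smul_left, mmRead_smul]
  simp only [Pi.smul_apply, smul_eq_mul]
  ring

/-! ## §3 The step stencil and an2's first tables: a quadratic part and a linear part -/

/-- [folklore] **THE STEP STENCIL UNDER COLOUR SCALING: QUADRATIC PART + LINEAR PART**:
`Sstep (t·cE) (t·cVH) (t·cΛ) j κ u = t² • ((cE·wE j) • e3Of cE cVH cΛ j κ u) + t • Sstep 0 cVH cΛ j κ u` — the value-function third jet enters multiplied by `cE` once more,
the one-step border and the Lagrange stencil carry one colour constant each. -/
theorem Sstep_colourScale (t cE cVH cΛ : ℝ) (j : ℕ) (κ : Fin (d + 1)) (u : Fin (d + 1) → ℤ) :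
    Sstep d Lc (t * cE) (t * cVH) (t * cΛ) j κ u =
      t ^ 2 • ((cE * BalabanStepJetsSucc.wE d Lc j) • e3Of d Lc cE cVH cΛ j κ u) + t • Sstep d Lc 0 cVH cΛ j κ u := by
  funext x z a b
  simp only [BalabanStepJetsSucc.Sstep, e3Of_colourScale, Pi.add_apply, Pi.smul_apply, smul_eq_mul, zero_mul]
  ring

/-- [folklore] Member `0` of an2's unfolded first field stencil is homogeneous of degree 1 (no third jet at the first step). -/
theorem Spure_colourScale_zero (t cE cVH cΛ : ℝ) : Spure d Lc (t * cE) (t * cVH) (t * cΛ) 0 = t • Spure d Lc cE cVH cΛ 0 := by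
  funext κ u x z a b
  simp only [BalabanStepW2.Spure, Pi.add_apply, Pi.smul_apply, smul_eq_mul]
  ring

/-- [folklore] **an2's UNFOLDED FIRST FIELD STENCIL AT LEVEL `j+1` UNDER COLOUR SCALING**:
`Spure (t·cE) (t·cVH) (t·cΛ) (j+1) κ u = t² • ((cE·wE (j+1)) • e3Of cE cVH cΛ (j+1) κ u) + t • Spure 0 cVH cΛ (j+1) κ u`. -/
theorem Spure_colourScale_succ (t cE cVH cΛ : ℝ) (j : ℕ) (κ : Fin (d + 1)) (u : Fin (d + 1) → ℤ) :
    Spure d Lc (t * cE) (t * cVH) (t * cΛ) (j + 1) κ u =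
      t ^ 2 • ((cE * BalabanStepJetsSucc.wE d Lc (j + 1)) • e3Of d Lc cE cVH cΛ (j + 1) κ u) + t • Spure d Lc 0 cVH cΛ (j + 1) κ u := by
  funext x z a b
  simp only [BalabanStepW2.Spure, e3Of_colourScale, Pi.add_apply, Pi.smul_apply, smul_eq_mul, zero_mul]
  ring

omit [NeZero Lc] in
/-- [folklore] an2's first multiplier table is homogeneous of degree 1 in `cΛ`. -/
theorem M1_colourScale (t cΛ : ℝ) (j : ℕ) : M1 d Lc (t * cΛ) j = t • M1 d Lc cΛ j := by
  funext ρ w x z a b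
  simp only [BalabanStepW2.M1, Pi.smul_apply, smul_eq_mul]
  ring

end Summit.QuantumFields.BalabanUV.Gaps.D1PinnedColourScaling

end
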